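import Literature.Analysis.ValidatedNumerics.GaussLegendreCert
import HarnessLib

/-!
# Kernel-checked tensor-product Gauss–Legendre cubature certificates: enclosures of
# `∫ₐᵇ ∫_c^d f(x, y) dy dx` for integrands analytic in each variable, by one `decide`

Trunk T-ANA (Analysis/ValidatedNumerics); namespace `Literature.Analysis.ValidatedNumerics.GaussLegendre2D`.
Sequel of `GaussLegendreCert.lean` (the one-dimensional certificate: the ellipse majorant calculus `EB`/`EBnd`,
the exact integer sign test `legInt` isolating the nodes, Bonnet's recursion `legPair` enclosing the weights, the
interval kernels `MI`/`MC`, the untrusted node search `glCands`) and of `Quadrature/GaussLegendreAnalytic.lean`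
(the ANALYSIS: `norm_integral_sub_gaussLegendre_le_interval`, Trefethen's Thm. 4.5 transported to `[a, b]`).
THE PROBLEM (Davis–Rabinowitz, Sect. 5.6): over a rectangle `[a, b] × [c, d]` the natural rule is the Cartesian
PRODUCT `R × S` of two one-dimensional rules ((5.6.3): nodes `(x_i, y_j)`, weights `v_i w_j`), and HABER'S
ERROR ESTIMATE bounds its error by `E₁ + A₁ E₂`: the error `E₁` of the inner rule (uniformly in the outer
variable) integrated over the outer interval, plus the sum `A₁` of the absolute weights of one rule times the error
`E₂` of the other (uniformly in the remaining variable).  For an integrand with a bounded holomorphic continuation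
IN EACH VARIABLE SEPARATELY to the Bernstein ellipses `E_{ρ₁}` of `[a, b]` (for every real `y ∈ [c, d]`) and
`E_{ρ₂}` of `[c, d]` (for every real `x ∈ [a, b]`), the two uniform errors are Trefethen's
`(b−a)/2 · 8M₁/((ρ₁−1)ρ₁^{2n₁+1})` and `(d−c)/2 · 8M₂/((ρ₂−1)ρ₂^{2n₂+1})`, and the Gauss–Legendre weights being
positive, `A₁ = d − c`.  A CERTIFICATE needs (i) certified `M₁`, `M₂` INCLUDING the holomorphy of the two
families of continuations, (ii) certified nodes and weights of both rules, (iii) a rigorous evaluation of the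
double sum — `(n₁+1)(n₂+1)` integrand values — and (iv) the measurability/integrability bookkeeping that makes the
iterated integral meaningful.  This module supplies all four, for a code list of integrands in two variables, so
that ONE `decide` proves `∫ₐᵇ ∫_c^d f ∈ [lo, hi]`.  Four parts:

* Part A — SYNTAX AND SEMANTICS: `E2` (the variables `X`, `Y`, rational constants, rational scaling, `+ − ×`,
  natural powers, `exp cos sin ⁻¹ √`), complex semantics `evalC2` (principal `√`), real semantics `evalR2`,
  joint measurability `measurable_evalR2`.
* Part B — THE CERTIFIED MAJORANT IN TWO VARIABLES: the ellipse-bound arithmetic of the one-dimensional module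
  run with TWO input boxes, `ebnd2 Bx By e : EB` — the variable of integration lives in Petras's rectangle
  `EB.varB ρ a b` around its ellipse, the other (REAL) variable in the degenerate box `realB c d` (`c ≤ Re ≤ d`,
  `Im = 0`); side conditions `eok2` (reciprocals: `lb > 0`; radicands: `relo > 0`); ONE induction `ebnd2_evalC2`
  gives the bounds AND complex differentiability in each variable; `evalC2_ofReal` (at real points the complex
  semantics is the real integrand).
* Part C — THE ERROR THEOREMS: the generic transported bound `abs_integral_sub_gl_le_of` (any real `f` with a
  bounded holomorphic continuation `F`), its two instances `abs_integral_sub_gl_le_y` (sections `y ↦ f(x, y)`,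
  boxes `(realB a b, varB ρ₂ c d)`) and `abs_integral_sub_gl_le_x` (boxes `(varB ρ₁ a b, realB c d)`), the
  integrability lemmas (measurable and bounded on the rectangle), and HABER'S ESTIMATE `abs_integral2_sub_gl2_le`:
  `|∫ₐᵇ∫_c^d f − Σ_i Σ_j v_i w_j f(x_i, y_j)| ≤ (b − a) ε_y + (d − c) ε_x`.
* Part D — THE KERNEL: per axis, `nodeW` (a candidate `c : ℤ` names the bracket `[(c−1)/T, (c+1)/T]`, accepted
  iff the exact integers `legInt` show a sign change of `P_{n+1}`; the weight enclosed by `2(1−x²)/((n+1)² P_n(x)²)`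
  on the bracket), `axisNW` (node and weight transported to the axis interval, scale `S`), the tables `axisTab`;
  the bivariate interval evaluator `evalI2` (`mem_evalI2`); the folded double sum `rowSum`/`dblSum` with their
  soundness; the error radius `errQ2`, data `glData2`, the Boolean CERTIFICATE `glCheck2D` (integer arithmetic
  only) and the MAIN THEOREM `integral_mem_of_glCheck2D : glCheck2D … = true → ∫ₐᵇ ∫_c^d evalR2 e x y ∈ [lo, hi]`
  (the `n₁+1`, resp. `n₂+1`, separated accepted brackets isolate exactly the nodes of each rule: `axis_nodes`, by
  `existsUnique_gaussLegendreNode_mem_Icc` / `exists_gaussLegendreNode_mem_Ioo`); finally the self-contained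
  `glCheck2 … := glCheck2D … (glCands n₁ T) (glCands n₂ T) …` with `integral_mem_of_glCheck2`.

Parameters (chosen by the untrusted proposer; any values that pass are sound): `ρ₁`, `ρ₂` below the largest
ellipse parameters free of singularities of the sections AS SEEN BY THE MAJORANT CALCULUS (rectangles and corner
hulls; the other variable ranges over its whole real interval); `n₁`, `n₂` (error `∝ ρ^{−2n}` per axis); the sum
scale `S ≈ 10^{digits+5}`; the bracket scale `T ≈ S · 2^{3n/2+10}`; `K` Taylor/Machin terms, `k` argument
halvings as in the one-dimensional module.  Kernel cost: two weight tables (`O(n²)` interval operations each) and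
`(n₁+1)(n₂+1)` bivariate interval evaluations — `10–80 s` for `400–1000` points at `33–65` digits.

Worked end to end (scratch kept OUT of the tree, `Certquad.ScratchGaussLegendre2D`, five files on top of this
module and its parent, `67 + 24 + 73 + 94 + 42 s` wall, `≈ 12 s` of which is the two modules each time; files
1, 3, 4, 5 ran concurrently on one farm node), each by ONE `decide +kernel` of `glCheck2D` (node candidates pasted from
`#eval glCands n T`) followed by `simp only [evalR2]; push_cast` to display the integrand, all on `[0, 1]²`:
`∫∫ e^{xy}` (`= Ei 1 − γ = Σ_{k≥1} 1/(k·k!)`; entire; `ρ₁ = ρ₂ = 64`, `21 × 21` points, `S = 2²³⁰`, `T = 2²⁷⁰`,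
`K = 24`) to width `6.3·10⁻⁶⁶`; `∫∫ dy dx/(1 + xy)` (`= π²/12`; pole set `xy = −1`; `ρ₁ = ρ₂ = 5`, the box
majorant certifying `|1 + xy| ≥ 1/5`; `31 × 31` points, `S = 2¹⁵⁰`) to `6.0·10⁻⁴²`; `∫∫ e^{−x²−y²}`
(`= (∫₀¹ e^{−t²})²`; `ρ₁ = ρ₂ = 10`, `26 × 26`, `S = 2¹⁶⁵`) to `1.6·10⁻⁴⁶`; `∫∫ cos(x + y)` (`= 2 cos 1 − cos 2 − 1`;
argument reduction by `MI.pi`; `ρ₁ = ρ₂ = 16`, `21 × 21`, `S = 2¹⁷⁰`, `K = 44`) to `1.3·10⁻⁴⁷`; and, by the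
SELF-CONTAINED `glCheck2` (both Newton searches `glCands 14 (2¹⁶⁰)` run inside the kernel), `∫∫ cos(x + y)` by
`15 × 15` points (`S = 2¹²⁸`, `K = 32`) to `3.9·10⁻³⁴` in `42 s`.  In every case the published value of the
integral lies inside the certified interval (it must: the theorem is unconditional).

Honest framing.  These are shared numerical engines serving client cells; rigour lives in the verifiers (the
soundness theorems below, whose only hypothesis is a Boolean certificate decided by the kernel); every published
number belongs to a client cell's ledger, not to the engines group.  ANCHOR / nearest in-tree relatives:
`GaussLegendreCert` (USED: majorant atoms `EBnd.*`, `legInt`, `legPair`, `ofRat`, `powI`, `bscale`, `glCands`),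
`Quadrature.GaussLegendreAnalytic` (USED: the complex analysis), `SpecialFunctions.GaussLegendreQuadrature`
(USED: nodes in `(−1, 1)`, positive weights summing to `2`), `ValidatedNumerics.SignChangeRootIsolation` (USED:
node isolation), `MultiPrecisionInterval` / `PeriodicTrapezoidCert` (USED: `MI`/`MC` kernels, `sqrtI`, `invI`),
`TaylorModelIntegralCert2D` (the algebraic-order sibling over rectangles: Taylor models, no analyticity used),
`Quadrature.TensorProductRuleError` (the abstract `d`-fold tensor-rule recursion, not used: it needs the partial
integrals to be rule-approximable, i.e. holomorphy of parametric integrals; Haber's two-term splitting below needs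
only the sections).  Nearest prior art in print: product Gauss rules and Haber's estimate (Davis–Rabinowitz
Sect. 5.6), the self-validating one-dimensional integrators of Petras and of Arb (Petras–Johansson), formally
verified quadrature in Coq (CoqInterval: one variable, polynomial enclosures); no proof-kernel certificate for
product Gauss–Legendre cubature is known to us — here nodes, weights, both majorants and the double sum are all
re-certified inside the kernel and the error radius is a closed-form rational.  Deliberately NOT here:
non-rectangular regions (generalized product rules, Sect. 5.6.1), adaptivity/bisection, dimension `d ≥ 3` (the same
splitting iterates: `E₁ + A₁E₂ + A₁A₂E₃ + …`), endpoint singularities, the product-measure (Fubini) form of the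
statement, sharper majorants (true ellipse images), floating point.  Problem-independent; no facts, no axioms; all
certificate data computable over `ℚ` and `ℤ`.

References: [cite: DavisRabinowitz1984, Sect. 5.6 (5.6.3)]; [cite: Trefethen2008, Thm. 4.5];
[cite: Petras2002, Sect. 3 (2)]; [cite: Petras2002, Sect. 5.1]; [cite: Johansson2018, Sect. 2];
[cite: JohanssonMezzarobba2018, Sect. 7.2]; [cite: Szego1939, Thm. 3.3.1]; [cite: Szego1939, Thm. 3.4.2];
[cite: CastilloPetronilho2024, Thm. 3.4]; [cite: AbramowitzStegun1964, 25.4.29]; [cite: Moore1979, Thm. 3.1];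
[cite: Moore1979, Sect. 3.3]; [cite: Moore1979, Sect. 4.4 (4.11)]; [cite: Moore1979, Sect. 4.4 (4.12)];
[cite: MahboubiMelquiondSibutpinote2016, Sect. 4.1].

AI-produced formalisation (H21 engines group, seat eng-quad-3 gen 63, 2026-08-23); no facts, no axioms, no `sorry`.
-/

open scoped Real Interval
open MeasureTheory intervalIntegral Set

namespace Literature.Analysis.ValidatedNumerics

namespace GaussLegendre2D

open Literature.Analysis.ValidatedNumerics.NumericsMP
open Literature.Analysis.ValidatedNumerics.PeriodicTrapezoid (expUb sqrtI invI mem_sqrtI mem_invI)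
open Literature.Analysis.ValidatedNumerics.GaussLegendre
open Literature.Analysis.SpecialFunctions (legendre gaussLegendreNodes gaussLegendreWeight
  mem_Ioo_of_mem_gaussLegendreNodes gaussLegendreWeight_pos sum_gaussLegendreWeight)

/-! ### Part A. The integrand language in two variables: syntax, complex and real semantics -/

/-- The integrand language: expressions in the two variables `X`, `Y` built from rational constants
by rational scaling, `+ − ×`, natural powers, `exp cos sin`, reciprocal and (principal) square root — a
code list in the sense of interval analysis. [cite: Moore1979, Sect. 4.4 (4.11)] -/
inductive E2 : Type
  | X : E2
  | Y : E2
  | const (c : ℚ) : E2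
  | scale (q : ℚ) (e : E2) : E2
  | add (e f : E2) : E2
  | sub (e f : E2) : E2
  | neg (e : E2) : E2
  | mul (e f : E2) : E2
  | pow (e : E2) (n : ℕ) : E2
  | exp (e : E2) : E2
  | cos (e : E2) : E2
  | sin (e : E2) : E2
  | inv (e : E2) : E2
  | sqrt (e : E2) : E2
  deriving Repr

/-- Complex semantics in both variables (the analytic continuations of the sections of the
integrand; `√` is the principal branch `w ^ (1/2)`). [cite: Trefethen2008, Thm. 4.5] -/
noncomputable def evalC2 : E2 → ℂ → ℂ → ℂ
  | .X, z, _ => z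
  | .Y, _, w => w
  | .const c, _, _ => (c : ℂ)
  | .scale q e, z, w => (q : ℂ) * evalC2 e z w
  | .add e f, z, w => evalC2 e z w + evalC2 f z w
  | .sub e f, z, w => evalC2 e z w - evalC2 f z w
  | .neg e, z, w => -evalC2 e z w
  | .mul e f, z, w => evalC2 e z w * evalC2 f z w
  | .pow e n, z, w => evalC2 e z w ^ n
  | .exp e, z, w => Complex.exp (evalC2 e z w)
  | .cos e, z, w => Complex.cos (evalC2 e z w)
  | .sin e, z, w => Complex.sin (evalC2 e z w)
  | .inv e, z, w => (evalC2 e z w)⁻¹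
  | .sqrt e, z, w => evalC2 e z w ^ (((1 : ℝ) / 2 : ℝ) : ℂ)

/-- Real semantics: the integrand `f(x, y)`. [cite: DavisRabinowitz1984, Sect. 5.6 (5.6.3)] -/
noncomputable def evalR2 : E2 → ℝ → ℝ → ℝ
  | .X, s, _ => s
  | .Y, _, t => t
  | .const c, _, _ => (c : ℝ)
  | .scale q e, s, t => (q : ℝ) * evalR2 e s t
  | .add e f, s, t => evalR2 e s t + evalR2 f s t
  | .sub e f, s, t => evalR2 e s t - evalR2 f s t
  | .neg e, s, t => -evalR2 e s t
  | .mul e f, s, t => evalR2 e s t * evalR2 f s t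
  | .pow e n, s, t => evalR2 e s t ^ n
  | .exp e, s, t => Real.exp (evalR2 e s t)
  | .cos e, s, t => Real.cos (evalR2 e s t)
  | .sin e, s, t => Real.sin (evalR2 e s t)
  | .inv e, s, t => (evalR2 e s t)⁻¹
  | .sqrt e, s, t => Real.sqrt (evalR2 e s t)

/-- Joint (Borel) measurability of the integrand (the Fubini bookkeeping of the iterated integral).
[cite: DavisRabinowitz1984, Sect. 5.6 (5.6.3)] -/
theorem measurable_evalR2 : ∀ e : E2, Measurable fun p : ℝ × ℝ => evalR2 e p.1 p.2
  | .X => measurable_fst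
  | .Y => measurable_snd
  | .const _ => measurable_const
  | .scale _ e => (measurable_evalR2 e).const_mul _
  | .add e f => (measurable_evalR2 e).add (measurable_evalR2 f)
  | .sub e f => (measurable_evalR2 e).sub (measurable_evalR2 f)
  | .neg e => (measurable_evalR2 e).neg
  | .mul e f => (measurable_evalR2 e).mul (measurable_evalR2 f)
  | .pow e n => (measurable_evalR2 e).pow_const n
  | .exp e => (measurable_evalR2 e).exp
  | .cos e => (measurable_evalR2 e).cos
  | .sin e => (measurable_evalR2 e).sin
  | .inv e => (measurable_evalR2 e).inv
  | .sqrt e => (measurable_evalR2 e).sqrt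

/-! ### Part B. The certified majorant in two variables -/

/-- Ellipse data of a REAL variable ranging over `[c, d]` (the variable that is not being continued):
`|t| ≤ max(|c|, |d|)`, `|t| ≥ max(c, −d, 0)`, `c ≤ Re t ≤ d`, `Im t = 0`. [cite: Moore1979, Sect. 3.3] -/
def realB (c d : ℚ) : EB := ⟨max |c| |d|, max (max c (-d)) 0, c, d, 0, 0⟩

/-- Soundness of `realB`. [cite: Moore1979, Thm. 3.1] -/
theorem EBnd_realB {c d : ℚ} {t : ℝ} (ht : t ∈ Set.Icc (c : ℝ) d) : EBnd (t : ℂ) (realB c d) := by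
  have hn : ‖(t : ℂ)‖ = |t| := by rw [Complex.norm_real, Real.norm_eq_abs]
  refine ⟨?_, ?_, ?_, ?_, ?_, ?_⟩ <;> simp only [realB, hn, Complex.ofReal_re, Complex.ofReal_im] <;>
    push_cast
  · exact abs_le_max_abs_abs ht.1 ht.2
  · exact max_le (max_le (ht.1.trans (le_abs_self t)) ((neg_le_neg ht.2).trans (neg_le_abs t)))
      (abs_nonneg t)
  · exact ht.1
  · exact ht.2
  · exact le_rfl
  · exact le_rfl

/-- The ellipse data of an expression in two variables from the data `Bx`, `By` of the variables,
by structural recursion (the atoms are those of the one-dimensional calculus).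
[cite: Moore1979, Sect. 4.4 (4.11)] -/
def ebnd2 (Bx By : EB) : E2 → EB
  | .X => Bx
  | .Y => By
  | .const c => EB.constB c
  | .scale q e => EB.scaleB q (ebnd2 Bx By e)
  | .add e f => EB.addB (ebnd2 Bx By e) (ebnd2 Bx By f)
  | .sub e f => EB.subB (ebnd2 Bx By e) (ebnd2 Bx By f)
  | .neg e => EB.negB (ebnd2 Bx By e)
  | .mul e f => EB.mulB (ebnd2 Bx By e) (ebnd2 Bx By f)
  | .pow e n => EB.powB (ebnd2 Bx By e) n
  | .exp e => EB.expB (ebnd2 Bx By e)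
  | .cos e => EB.trigB (ebnd2 Bx By e)
  | .sin e => EB.trigB (ebnd2 Bx By e)
  | .inv e => EB.invB (ebnd2 Bx By e)
  | .sqrt e => EB.sqrtB (ebnd2 Bx By e)

/-- The side conditions making the continuations holomorphic: every reciprocal has a certified
positive lower bound of `|w|`, every radicand a certified positive lower bound of `Re w` (decided over
`ℚ`). [cite: Petras2002, Sect. 3 (2)] -/
def eok2 (Bx By : EB) : E2 → Bool
  | .X => true
  | .Y => true
  | .const _ => true
  | .scale _ e => eok2 Bx By e
  | .add e f => eok2 Bx By e && eok2 Bx By f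
  | .sub e f => eok2 Bx By e && eok2 Bx By f
  | .neg e => eok2 Bx By e
  | .mul e f => eok2 Bx By e && eok2 Bx By f
  | .pow e _ => eok2 Bx By e
  | .exp e => eok2 Bx By e
  | .cos e => eok2 Bx By e
  | .sin e => eok2 Bx By e
  | .inv e => eok2 Bx By e && decide (0 < (ebnd2 Bx By e).lb)
  | .sqrt e => eok2 Bx By e && decide (0 < (ebnd2 Bx By e).relo)

/-- A point with certified positive `lb` is nonzero. [folklore] -/
private theorem ne_zero_of_lb {z : ℂ} {A : EB} (hz : EBnd z A) (hlb : 0 < A.lb) : z ≠ 0 := by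
  have hlb' : (0 : ℝ) < A.lb := by exact_mod_cast hlb
  exact norm_pos_iff.mp (hlb'.trans_le hz.le_norm)

/-- A point with certified positive `relo` lies in the slit plane. [folklore] -/
private theorem mem_slitPlane_of_relo {z : ℂ} {A : EB} (hz : EBnd z A) (h : 0 < A.relo) :
    z ∈ Complex.slitPlane := by
  have h' : (0 : ℝ) < A.relo := by exact_mod_cast h
  exact Complex.mem_slitPlane_iff.mpr (Or.inl (h'.trans_le hz.le_re))

/-- **Soundness of the majorant calculus in two variables.**  If the side conditions hold, then at
every pair of points satisfying the data of the variables, the value of every subexpression satisfies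
its ellipse data AND the continuation is complex-differentiable in each variable separately (one
induction). [cite: Moore1979, Thm. 3.1] [cite: Petras2002, Sect. 3 (2)] -/
theorem ebnd2_evalC2 {Bx By : EB} :
    ∀ (e : E2), eok2 Bx By e = true → ∀ z w : ℂ, EBnd z Bx → EBnd w By →
      EBnd (evalC2 e z w) (ebnd2 Bx By e) ∧ DifferentiableAt ℂ (fun u => evalC2 e u w) z ∧
        DifferentiableAt ℂ (fun u => evalC2 e z u) w := by
  intro e
  induction e with
  | X =>
    intro _ z w hz _
    simp only [evalC2, ebnd2]
    exact ⟨hz, differentiableAt_id, differentiableAt_const _⟩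
  | Y =>
    intro _ z w _ hw
    simp only [evalC2, ebnd2]
    exact ⟨hw, differentiableAt_const _, differentiableAt_id⟩
  | const c =>
    intro _ z w _ _
    simp only [evalC2, ebnd2]
    exact ⟨EBnd.const c, differentiableAt_const _, differentiableAt_const _⟩
  | scale q e ih =>
    intro hok z w hz hw
    simp only [eok2] at hok
    have h1 := ih hok z w hz hw
    simp only [evalC2, ebnd2]
    exact ⟨h1.1.scale q, h1.2.1.const_mul _, h1.2.2.const_mul _⟩
  | add e f ihe ihf =>
    intro hok z w hz hw
    simp only [eok2, Bool.and_eq_true] at hok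
    have h1 := ihe hok.1 z w hz hw
    have h2 := ihf hok.2 z w hz hw
    simp only [evalC2, ebnd2]
    exact ⟨h1.1.add h2.1, h1.2.1.add h2.2.1, h1.2.2.add h2.2.2⟩
  | sub e f ihe ihf =>
    intro hok z w hz hw
    simp only [eok2, Bool.and_eq_true] at hok
    have h1 := ihe hok.1 z w hz hw
    have h2 := ihf hok.2 z w hz hw
    simp only [evalC2, ebnd2]
    exact ⟨h1.1.sub h2.1, h1.2.1.sub h2.2.1, h1.2.2.sub h2.2.2⟩
  | neg e ih =>
    intro hok z w hz hw
    simp only [eok2] at hok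
    have h1 := ih hok z w hz hw
    simp only [evalC2, ebnd2]
    exact ⟨h1.1.neg, h1.2.1.neg, h1.2.2.neg⟩
  | mul e f ihe ihf =>
    intro hok z w hz hw
    simp only [eok2, Bool.and_eq_true] at hok
    have h1 := ihe hok.1 z w hz hw
    have h2 := ihf hok.2 z w hz hw
    simp only [evalC2, ebnd2]
    exact ⟨h1.1.mul h2.1, h1.2.1.mul h2.2.1, h1.2.2.mul h2.2.2⟩
  | pow e n ih =>
    intro hok z w hz hw
    simp only [eok2] at hok
    have h1 := ih hok z w hz hw
    simp only [evalC2, ebnd2]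
    exact ⟨h1.1.pow n, h1.2.1.pow n, h1.2.2.pow n⟩
  | exp e ih =>
    intro hok z w hz hw
    simp only [eok2] at hok
    have h1 := ih hok z w hz hw
    simp only [evalC2, ebnd2]
    exact ⟨h1.1.exp, h1.2.1.cexp, h1.2.2.cexp⟩
  | cos e ih =>
    intro hok z w hz hw
    simp only [eok2] at hok
    have h1 := ih hok z w hz hw
    simp only [evalC2, ebnd2]
    exact ⟨h1.1.cos, h1.2.1.ccos, h1.2.2.ccos⟩
  | sin e ih =>
    intro hok z w hz hw
    simp only [eok2] at hok
    have h1 := ih hok z w hz hw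
    simp only [evalC2, ebnd2]
    exact ⟨h1.1.sin, h1.2.1.csin, h1.2.2.csin⟩
  | inv e ih =>
    intro hok z w hz hw
    simp only [eok2, Bool.and_eq_true, decide_eq_true_eq] at hok
    have h1 := ih hok.1 z w hz hw
    simp only [evalC2, ebnd2]
    exact ⟨h1.1.inv hok.2, h1.2.1.inv (ne_zero_of_lb h1.1 hok.2),
      h1.2.2.inv (ne_zero_of_lb h1.1 hok.2)⟩
  | sqrt e ih =>
    intro hok z w hz hw
    simp only [eok2, Bool.and_eq_true, decide_eq_true_eq] at hok
    have h1 := ih hok.1 z w hz hw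
    simp only [evalC2, ebnd2]
    exact ⟨h1.1.sqrt, h1.2.1.cpow_const (mem_slitPlane_of_relo h1.1 hok.2),
      h1.2.2.cpow_const (mem_slitPlane_of_relo h1.1 hok.2)⟩

/-- At real points satisfying the data, the complex semantics is the real integrand.
[cite: Trefethen2008, Thm. 4.5] -/
theorem evalC2_ofReal {Bx By : EB} :
    ∀ (e : E2), eok2 Bx By e = true → ∀ s t : ℝ, EBnd (s : ℂ) Bx → EBnd (t : ℂ) By →
      evalC2 e (s : ℂ) (t : ℂ) = ((evalR2 e s t : ℝ) : ℂ) := by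
  intro e
  induction e with
  | X => intro _ s t _ _; simp only [evalC2, evalR2]
  | Y => intro _ s t _ _; simp only [evalC2, evalR2]
  | const c => intro _ s t _ _; simp only [evalC2, evalR2]; push_cast; rfl
  | scale q e ih =>
    intro hok s t hs ht
    simp only [eok2] at hok
    simp only [evalC2, evalR2, ih hok s t hs ht]
    push_cast
    rfl
  | add e f ihe ihf =>
    intro hok s t hs ht
    simp only [eok2, Bool.and_eq_true] at hok
    simp only [evalC2, evalR2, ihe hok.1 s t hs ht, ihf hok.2 s t hs ht]
    push_cast
    rfl
  | sub e f ihe ihf =>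
    intro hok s t hs ht
    simp only [eok2, Bool.and_eq_true] at hok
    simp only [evalC2, evalR2, ihe hok.1 s t hs ht, ihf hok.2 s t hs ht]
    push_cast
    rfl
  | neg e ih =>
    intro hok s t hs ht
    simp only [eok2] at hok
    simp only [evalC2, evalR2, ih hok s t hs ht]
    push_cast
    rfl
  | mul e f ihe ihf =>
    intro hok s t hs ht
    simp only [eok2, Bool.and_eq_true] at hok
    simp only [evalC2, evalR2, ihe hok.1 s t hs ht, ihf hok.2 s t hs ht]
    push_cast
    rfl
  | pow e n ih =>
    intro hok s t hs ht
    simp only [eok2] at hok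
    simp only [evalC2, evalR2, ih hok s t hs ht]
    push_cast
    rfl
  | exp e ih =>
    intro hok s t hs ht
    simp only [eok2] at hok
    simp only [evalC2, evalR2, ih hok s t hs ht]
    exact (Complex.ofReal_exp _).symm
  | cos e ih =>
    intro hok s t hs ht
    simp only [eok2] at hok
    simp only [evalC2, evalR2, ih hok s t hs ht]
    exact (Complex.ofReal_cos _).symm
  | sin e ih =>
    intro hok s t hs ht
    simp only [eok2] at hok
    simp only [evalC2, evalR2, ih hok s t hs ht]
    exact (Complex.ofReal_sin _).symm
  | inv e ih =>
    intro hok s t hs ht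
    simp only [eok2, Bool.and_eq_true, decide_eq_true_eq] at hok
    simp only [evalC2, evalR2, ih hok.1 s t hs ht]
    exact (Complex.ofReal_inv _).symm
  | sqrt e ih =>
    intro hok s t hs ht
    simp only [eok2, Bool.and_eq_true, decide_eq_true_eq] at hok
    have hpos : 0 ≤ evalR2 e s t := by
      have h1 := (ebnd2_evalC2 e hok.1 (s : ℂ) (t : ℂ) hs ht).1.le_re
      rw [ih hok.1 s t hs ht, Complex.ofReal_re] at h1
      have h2 : (0 : ℝ) < (ebnd2 Bx By e).relo := by exact_mod_cast hok.2
      linarith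
    simp only [evalC2, evalR2, ih hok.1 s t hs ht]
    rw [Real.sqrt_eq_rpow, Complex.ofReal_cpow hpos]

/-- The pointwise bound of the integrand on the rectangle from the `y`-direction data (the real point
`(x, y)` has `x` in `realB a b` and `y` on the segment of the ellipse `E_{ρ₂}` of `[c, d]`).
[cite: Trefethen2008, Thm. 4.5] -/
theorem abs_evalR2_le {e : E2} {a b c d ρ : ℚ} (hρ : 1 < ρ) (hcd : c < d)
    (hok : eok2 (realB a b) (EB.varB ρ c d) e = true) {s t : ℝ} (hs : s ∈ Set.Icc (a : ℝ) b)
    (ht : t ∈ Set.Icc (c : ℝ) d) :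
    |evalR2 e s t| ≤ ((ebnd2 (realB a b) (EB.varB ρ c d) e).ub : ℝ) := by
  have hsB := EBnd_realB hs
  have htB : EBnd (t : ℂ) (EB.varB ρ c d) := EBnd.var hρ hcd (ofReal_mem_ell hρ hcd ht)
  have h := (ebnd2_evalC2 e hok (s : ℂ) (t : ℂ) hsB htB).1.norm_le
  rw [evalC2_ofReal e hok s t hsB htB, Complex.norm_real, Real.norm_eq_abs] at h
  exact h

/-! ### Part C. The error theorems: one direction at a time, then Haber's product-rule estimate -/

/-- The `(n+1)`-point Gauss–Legendre rule transported to `[a, b]`, applied to `f`: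
`R(f) = Σ_x (b−a)/2 · λ_x · f((b−a)/2·x + (a+b)/2)`. [cite: DavisRabinowitz1984, Sect. 5.6 (5.6.3)] -/
noncomputable def glRule (n : ℕ) (a b : ℝ) (f : ℝ → ℝ) : ℝ :=
  ∑ x ∈ gaussLegendreNodes (n + 1),
    (b - a) / 2 * gaussLegendreWeight (n + 1) x * f ((b - a) / 2 * x + (a + b) / 2)

/-- The transported nodes lie in `[a, b]`. [cite: Szego1939, Thm. 3.3.1] -/
theorem node_mem_Icc {a b : ℝ} (hab : a ≤ b) {n : ℕ} {x : ℝ} (hx : x ∈ gaussLegendreNodes n) :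
    (b - a) / 2 * x + (a + b) / 2 ∈ Icc a b := by
  have hxI := mem_Ioo_of_mem_gaussLegendreNodes hx
  constructor <;> nlinarith [hxI.1, hxI.2]

/-- The transported weights are nonnegative. [cite: Szego1939, Thm. 3.4.2] -/
theorem weight_nonneg {a b : ℝ} (hab : a ≤ b) {n : ℕ} {x : ℝ} (hx : x ∈ gaussLegendreNodes n) :
    0 ≤ (b - a) / 2 * gaussLegendreWeight n x :=
  mul_nonneg (by linarith) (gaussLegendreWeight_pos hx).le

/-- The transported weights sum to `b − a` (`A = Σ |weights|` of Haber's estimate).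
[cite: CastilloPetronilho2024, Thm. 3.4] -/
theorem sum_weight (a b : ℝ) (n : ℕ) :
    ∑ x ∈ gaussLegendreNodes (n + 1), (b - a) / 2 * gaussLegendreWeight (n + 1) x = b - a := by
  rw [← Finset.mul_sum, sum_gaussLegendreWeight (by omega)]
  ring

/-- **Gauss–Legendre quadrature of a real integrand with a bounded holomorphic continuation to the
Bernstein ellipse of `[a, b]`** (Trefethen's (4.14) transported): if `F` is holomorphic on the open
ellipse `|z − a| + |z − b| < (ρ + ρ⁻¹)(b − a)/2`, bounded by `M` there, and restricts to `f` on
`[a, b]`, then `|∫ₐᵇ f − R(f)| ≤ (b−a)/2 · 8M/((ρ − 1)ρ^{2n+1})` for the `(n+1)`-point rule.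
[cite: Trefethen2008, Thm. 4.5] -/
theorem abs_integral_sub_gl_le_of {F : ℂ → ℂ} {f : ℝ → ℝ} {ρ M a b : ℝ} (hρ : 1 < ρ) (hab : a < b)
    (hF : DifferentiableOn ℂ F {z : ℂ | ‖z - a‖ + ‖z - b‖ < (ρ + ρ⁻¹) * ((b - a) / 2)})
    (hM : ∀ z : ℂ, ‖z - a‖ + ‖z - b‖ < (ρ + ρ⁻¹) * ((b - a) / 2) → ‖F z‖ ≤ M)
    (hFf : ∀ t ∈ Icc a b, F t = f t) (n : ℕ) :
    |(∫ t in a..b, f t) - glRule n a b f| ≤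
      (b - a) / 2 * (8 * M / ((ρ - 1) * ρ ^ (2 * (n + 1) - 1))) := by
  have key := Literature.Analysis.Quadrature.norm_integral_sub_gaussLegendre_le_interval
    (f := F) (M := M) hρ hab hF hM (n := n + 1) (by omega)
  have hint : ∫ t in a..b, F t = ∫ t in a..b, ((f t : ℝ) : ℂ) := by
    refine intervalIntegral.integral_congr (fun t ht => ?_)
    rw [uIcc_of_le hab.le] at ht
    exact hFf t ht
  have hgl : ((glRule n a b f : ℝ) : ℂ) = ∑ x ∈ gaussLegendreNodes (n + 1),
      ((b - a) / 2 * gaussLegendreWeight (n + 1) x : ℂ) * F ((b - a) / 2 * x + (a + b) / 2) := by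
    unfold glRule
    rw [Complex.ofReal_sum]
    refine Finset.sum_congr rfl (fun x hx => ?_)
    have h1 : F ((b - a) / 2 * x + (a + b) / 2) =
        (((f ((b - a) / 2 * x + (a + b) / 2) : ℝ)) : ℂ) := by
      rw [← hFf _ (node_mem_Icc hab.le hx)]
      push_cast
      ring_nf
    rw [h1]
    push_cast
    ring
  have hC : ((((∫ t in a..b, f t) - glRule n a b f : ℝ)) : ℂ) =
      (∫ t in a..b, F t) - ∑ x ∈ gaussLegendreNodes (n + 1),
        ((b - a) / 2 * gaussLegendreWeight (n + 1) x : ℂ) * F ((b - a) / 2 * x + (a + b) / 2) := by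
    rw [Complex.ofReal_sub, hgl, hint, intervalIntegral.integral_ofReal]
  rw [← Real.norm_eq_abs, ← Complex.norm_real, hC]
  exact key

/-- **The `y`-direction, certified form.**  If `eok2 (realB a b) (varB ρ c d) e` (`ρ > 1`, `c < d`),
then for every real `x ∈ [a, b]` the section `y ↦ f(x, y)` continues holomorphically to the ellipse
`E_ρ` of `[c, d]` with the certified bound `ub`, so its `(n+1)`-point rule errs by at most
`(d−c)/2 · 8·ub/((ρ − 1) ρ^{2n+1})` — uniformly in `x`. [cite: Trefethen2008, Thm. 4.5]
[cite: Petras2002, Sect. 3 (2)] -/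
theorem abs_integral_sub_gl_le_y {e : E2} {a b c d ρ : ℚ} (hρ : 1 < ρ) (hcd : c < d)
    (hok : eok2 (realB a b) (EB.varB ρ c d) e = true) {s : ℝ} (hs : s ∈ Set.Icc (a : ℝ) b)
    (n : ℕ) :
    |(∫ t in (c : ℝ)..d, evalR2 e s t) - glRule n c d (evalR2 e s)| ≤
      ((d : ℝ) - c) / 2 * (8 * ((ebnd2 (realB a b) (EB.varB ρ c d) e).ub : ℝ) /
        (((ρ : ℝ) - 1) * (ρ : ℝ) ^ (2 * (n + 1) - 1))) := by
  have hρ1 : (1 : ℝ) < ρ := by exact_mod_cast hρ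
  have hcd' : (c : ℝ) < d := by exact_mod_cast hcd
  have hsB := EBnd_realB hs
  refine abs_integral_sub_gl_le_of (F := fun w => evalC2 e s w) hρ1 hcd' ?_ ?_ ?_ n
  · intro w hw
    exact ((ebnd2_evalC2 e hok (s : ℂ) w hsB (EBnd.var hρ hcd hw)).2.2).differentiableWithinAt
  · intro w hw
    exact (ebnd2_evalC2 e hok (s : ℂ) w hsB (EBnd.var hρ hcd hw)).1.norm_le
  · intro t ht
    exact evalC2_ofReal e hok s t hsB (EBnd.var hρ hcd (ofReal_mem_ell hρ hcd ht))

/-- **The `x`-direction, certified form.**  If `eok2 (varB ρ a b) (realB c d) e` (`ρ > 1`, `a < b`),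
then for every real `y ∈ [c, d]` the section `x ↦ f(x, y)` continues holomorphically to the ellipse
`E_ρ` of `[a, b]` with the certified bound `ub`, so its `(n+1)`-point rule errs by at most
`(b−a)/2 · 8·ub/((ρ − 1) ρ^{2n+1})` — uniformly in `y`. [cite: Trefethen2008, Thm. 4.5]
[cite: Petras2002, Sect. 3 (2)] -/
theorem abs_integral_sub_gl_le_x {e : E2} {a b c d ρ : ℚ} (hρ : 1 < ρ) (hab : a < b)
    (hok : eok2 (EB.varB ρ a b) (realB c d) e = true) {t : ℝ} (ht : t ∈ Set.Icc (c : ℝ) d)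
    (n : ℕ) :
    |(∫ s in (a : ℝ)..b, evalR2 e s t) - glRule n a b (fun s => evalR2 e s t)| ≤
      ((b : ℝ) - a) / 2 * (8 * ((ebnd2 (EB.varB ρ a b) (realB c d) e).ub : ℝ) /
        (((ρ : ℝ) - 1) * (ρ : ℝ) ^ (2 * (n + 1) - 1))) := by
  have hρ1 : (1 : ℝ) < ρ := by exact_mod_cast hρ
  have hab' : (a : ℝ) < b := by exact_mod_cast hab
  have htB := EBnd_realB ht
  refine abs_integral_sub_gl_le_of (F := fun z => evalC2 e z t) hρ1 hab' ?_ ?_ ?_ n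
  · intro z hz
    exact ((ebnd2_evalC2 e hok z (t : ℂ) (EBnd.var hρ hab hz) htB).2.1).differentiableWithinAt
  · intro z hz
    exact (ebnd2_evalC2 e hok z (t : ℂ) (EBnd.var hρ hab hz) htB).1.norm_le
  · intro s hs
    exact evalC2_ofReal e hok s t (EBnd.var hρ hab (ofReal_mem_ell hρ hab hs)) htB

/-! #### Integrability from measurability and a bound -/

/-- A measurable function bounded on `[a, b]` is interval integrable there. [folklore] -/
private theorem intervalIntegrable_of_bound {g : ℝ → ℝ} (hg : Measurable g) {a b M : ℝ} (hab : a ≤ b)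
    (hb : ∀ x ∈ Icc a b, |g x| ≤ M) : IntervalIntegrable g volume a b := by
  rw [intervalIntegrable_iff_integrableOn_Icc_of_le hab]
  refine Measure.integrableOn_of_bounded (M := M)
    (by rw [Real.volume_Icc]; exact ENNReal.ofReal_ne_top) hg.aestronglyMeasurable ?_
  refine (ae_restrict_iff' measurableSet_Icc).2 (Filter.Eventually.of_forall fun x hx => ?_)
  rw [Real.norm_eq_abs]
  exact hb x hx

/-- The inner integral of a jointly measurable function is measurable in the outer variable
(Fubini integrand). [folklore] -/
private theorem measurable_inner {f : ℝ → ℝ → ℝ} (hm : Measurable fun p : ℝ × ℝ => f p.1 p.2)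
    {c d : ℝ} (hcd : c ≤ d) : Measurable fun x => ∫ y in c..d, f x y := by
  have hsm : StronglyMeasurable (Function.uncurry f) := hm.stronglyMeasurable
  have h1 : StronglyMeasurable fun x => ∫ y, f x y ∂(volume.restrict (Set.Ioc c d)) :=
    hsm.integral_prod_right
  have e : (fun x => ∫ y in c..d, f x y) =
      fun x => ∫ y, f x y ∂(volume.restrict (Set.Ioc c d)) := by
    funext x; rw [intervalIntegral.integral_of_le hcd]
  rw [e]; exact h1.measurable

/-- The inner integral of a bounded function is bounded by `(d − c)·M`. [folklore] -/
private theorem abs_inner_le {f : ℝ → ℝ → ℝ} {c d M : ℝ} (hcd : c ≤ d) {x : ℝ}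
    (hb : ∀ y ∈ Icc c d, |f x y| ≤ M) : |∫ y in c..d, f x y| ≤ (d - c) * M := by
  have hpt : ∀ y ∈ Ι c d, ‖f x y‖ ≤ M := fun y hy => by
    rw [uIoc_of_le hcd] at hy
    rw [Real.norm_eq_abs]; exact hb y ⟨hy.1.le, hy.2⟩
  have := norm_integral_le_of_norm_le_const hpt
  rw [Real.norm_eq_abs, abs_of_nonneg (sub_nonneg.mpr hcd)] at this
  linarith

/-- Both integrability hypotheses of Haber's estimate from joint measurability and a bound on the
rectangle: the inner integral is integrable in `x`, every section is integrable in `x`.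
[cite: DavisRabinowitz1984, Sect. 5.6 (5.6.3)] -/
theorem integrable_of_measurable_bound {f : ℝ → ℝ → ℝ} (hm : Measurable fun p : ℝ × ℝ => f p.1 p.2)
    {a b c d M : ℝ} (hab : a ≤ b) (hcd : c ≤ d)
    (hb : ∀ x ∈ Icc a b, ∀ y ∈ Icc c d, |f x y| ≤ M) :
    IntervalIntegrable (fun x => ∫ y in c..d, f x y) volume a b ∧
      ∀ y ∈ Icc c d, IntervalIntegrable (fun x => f x y) volume a b := by
  refine ⟨intervalIntegrable_of_bound (measurable_inner hm hcd) hab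
    (fun x hx => abs_inner_le hcd (hb x hx)), fun y hy => ?_⟩
  exact intervalIntegrable_of_bound (hm.comp (measurable_id.prodMk measurable_const)) hab
    (fun x hx => hb x hx y hy)

/-! #### Haber's error estimate for the product rule (two dimensions) -/

/-- **Haber's error estimate for a product rule, `d = 2`.**  If the inner rule integrates
`y ↦ f(x, y)` over `[c, d]` to within `ε_y` for every `x ∈ [a, b]`, and the outer rule integrates
`x ↦ f(x, y)` over `[a, b]` to within `ε_x` for every `y ∈ [c, d]`, then the product rule `R × S`
((5.6.3): `Σ_i Σ_j v_i w_j f(x_i, y_j)`) integrates `f` over the rectangle to within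
`E₁ + A₁ E₂ = (b − a) ε_y + (d − c) ε_x` (`A₁ = Σ |weights| = d − c` for the positive Gauss–Legendre
weights); the double integral is the iterated one, the inner integral being integrable in `x`.
[cite: DavisRabinowitz1984, Sect. 5.6 (5.6.3)] -/
theorem abs_integral2_sub_gl2_le {f : ℝ → ℝ → ℝ} {a b c d εx εy : ℝ} (hab : a < b) (hcd : c < d)
    {n₁ n₂ : ℕ}
    (hy : ∀ x ∈ Icc a b, |(∫ y in c..d, f x y) - glRule n₂ c d (f x)| ≤ εy)
    (hx : ∀ y ∈ Icc c d, |(∫ x in a..b, f x y) - glRule n₁ a b (fun x => f x y)| ≤ εx)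
    (hg : IntervalIntegrable (fun x => ∫ y in c..d, f x y) volume a b)
    (hs : ∀ y ∈ Icc c d, IntervalIntegrable (fun x => f x y) volume a b) :
    |(∫ x in a..b, ∫ y in c..d, f x y) -
        ∑ ξ ∈ gaussLegendreNodes (n₁ + 1), ∑ η ∈ gaussLegendreNodes (n₂ + 1),
          (b - a) / 2 * gaussLegendreWeight (n₁ + 1) ξ *
            ((d - c) / 2 * gaussLegendreWeight (n₂ + 1) η) *
              f ((b - a) / 2 * ξ + (a + b) / 2) ((d - c) / 2 * η + (c + d) / 2)| ≤
      (b - a) * εy + (d - c) * εx := by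
  set N₁ := gaussLegendreNodes (n₁ + 1) with hN₁
  set N₂ := gaussLegendreNodes (n₂ + 1) with hN₂
  set xn : ℝ → ℝ := fun ξ => (b - a) / 2 * ξ + (a + b) / 2 with hxn
  set yn : ℝ → ℝ := fun η => (d - c) / 2 * η + (c + d) / 2 with hyn
  set v : ℝ → ℝ := fun ξ => (b - a) / 2 * gaussLegendreWeight (n₁ + 1) ξ with hv
  set w : ℝ → ℝ := fun η => (d - c) / 2 * gaussLegendreWeight (n₂ + 1) η with hw
  have hynI : ∀ η ∈ N₂, yn η ∈ Icc c d := fun η hη => node_mem_Icc hcd.le hη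
  have hw0 : ∀ η ∈ N₂, 0 ≤ w η := fun η hη => weight_nonneg hcd.le hη
  have hwsum : ∑ η ∈ N₂, w η = d - c := sum_weight c d n₂
  set g : ℝ → ℝ := fun x => ∫ y in c..d, f x y with hgdef
  set s : ℝ → ℝ := fun x => ∑ η ∈ N₂, w η * f x (yn η) with hsdef
  have hs_eq : ∀ x, glRule n₂ c d (f x) = s x := fun x => rfl
  have hs_int : IntervalIntegrable s volume a b := by
    have e : s = ∑ η ∈ N₂, fun x => w η * f x (yn η) := by
      funext x; simp only [hsdef, Finset.sum_apply]
    rw [e]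
    exact IntervalIntegrable.sum N₂ (fun η hη => ((hs _ (hynI η hη)).const_mul (w η)))
  -- Step 1: the inner rule, integrated over `x`
  have h1 : |(∫ x in a..b, g x) - ∫ x in a..b, s x| ≤ (b - a) * εy := by
    rw [← intervalIntegral.integral_sub hg hs_int]
    have hpt : ∀ x ∈ Ι a b, ‖g x - s x‖ ≤ εy := by
      intro x hxab
      rw [uIoc_of_le hab.le] at hxab
      rw [Real.norm_eq_abs, ← hs_eq]
      exact hy x ⟨hxab.1.le, hxab.2⟩
    have := norm_integral_le_of_norm_le_const hpt
    rw [Real.norm_eq_abs, abs_of_pos (sub_pos.mpr hab)] at this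
    linarith
  -- Step 2: the integral of the finite sum
  have h2 : ∫ x in a..b, s x = ∑ η ∈ N₂, w η * ∫ x in a..b, f x (yn η) := by
    rw [hsdef, intervalIntegral.integral_finsetSum (fun η hη => (hs _ (hynI η hη)).const_mul (w η))]
    refine Finset.sum_congr rfl (fun η _ => ?_)
    exact intervalIntegral.integral_const_mul _ _
  -- Step 3: the outer rule at the inner nodes
  have hQ : ∑ ξ ∈ N₁, ∑ η ∈ N₂, v ξ * w η * f (xn ξ) (yn η) =
      ∑ η ∈ N₂, w η * glRule n₁ a b (fun x => f x (yn η)) := by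
    rw [Finset.sum_comm]
    refine Finset.sum_congr rfl (fun η _ => ?_)
    unfold glRule
    rw [Finset.mul_sum]
    refine Finset.sum_congr rfl (fun ξ _ => ?_)
    simp only [hv, hxn]
    ring
  have h3 : |(∑ η ∈ N₂, w η * ∫ x in a..b, f x (yn η)) -
      ∑ η ∈ N₂, w η * glRule n₁ a b (fun x => f x (yn η))| ≤ (d - c) * εx := by
    rw [← Finset.sum_sub_distrib]
    calc |∑ η ∈ N₂, ((w η * ∫ x in a..b, f x (yn η)) - w η * glRule n₁ a b (fun x => f x (yn η)))|
        ≤ ∑ η ∈ N₂, |(w η * ∫ x in a..b, f x (yn η)) - w η * glRule n₁ a b (fun x => f x (yn η))| :=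
          Finset.abs_sum_le_sum_abs _ _
      _ ≤ ∑ η ∈ N₂, w η * εx := by
          refine Finset.sum_le_sum (fun η hη => ?_)
          rw [← mul_sub, abs_mul, abs_of_nonneg (hw0 η hη)]
          exact mul_le_mul_of_nonneg_left (hx _ (hynI η hη)) (hw0 η hη)
      _ = (d - c) * εx := by rw [← Finset.sum_mul, hwsum]
  -- assemble
  have hQ' : ∑ ξ ∈ N₁, ∑ η ∈ N₂,
      (b - a) / 2 * gaussLegendreWeight (n₁ + 1) ξ *
        ((d - c) / 2 * gaussLegendreWeight (n₂ + 1) η) *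
          f ((b - a) / 2 * ξ + (a + b) / 2) ((d - c) / 2 * η + (c + d) / 2) =
      ∑ η ∈ N₂, w η * glRule n₁ a b (fun x => f x (yn η)) := by
    rw [← hQ]
  rw [hQ']
  have hsplit : (∫ x in a..b, g x) - ∑ η ∈ N₂, w η * glRule n₁ a b (fun x => f x (yn η)) =
      ((∫ x in a..b, g x) - ∫ x in a..b, s x) +
        ((∑ η ∈ N₂, w η * ∫ x in a..b, f x (yn η)) -
          ∑ η ∈ N₂, w η * glRule n₁ a b (fun x => f x (yn η))) := by
    rw [h2]
    ring
  rw [hsplit]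
  exact (abs_add_le _ _).trans (add_le_add h1 h3)

/-! ### Part D. The interval kernel: certified nodes and weights per axis, the double sum, the certificate -/

/-- **Node and weight enclosure of one bracket.**  The candidate `c` names the bracket
`[(c−1)/T, (c+1)/T]` of the reference interval `[−1, 1]`; the answer is `none` unless `P_{n+1}` has
opposite signs at the two ends (decided EXACTLY by `legInt`), in which case the bracket (as an
interval at scale `bscale T`) contains a node `x` of the `(n+1)`-point rule and `λ_x` is enclosed by
`2(1 − x²)/((n+1)² P_n(x)²)` evaluated on the bracket. [cite: Szego1939, Thm. 3.3.1]
[cite: AbramowitzStegun1964, 25.4.29] [cite: JohanssonMezzarobba2018, Sect. 7.2] -/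
def nodeW (n T : ℕ) (c : ℤ) : Option (MI × MI) :=
  let RA := (legInt T (c - 1) n).1
  let RB := (legInt T (c + 1) n).1
  if (RA < 0 ∧ 0 < RB) ∨ (0 < RA ∧ RB < 0) then
    let SP := bscale T
    let X : MI := MI.span (MI.ofFrac SP (c - 1) T) (MI.ofFrac SP (c + 1) T)
    match MI.divPos SP (((MI.ofInt SP 1).sub (MI.sqr SP X)).mulInt 2)
        ((MI.sqr SP (legPair SP X n).2).mulInt (((n : ℤ) + 1) ^ 2)) with
    | none => none
    | some W => some (X, W)
  else none

/-- **Soundness of `nodeW`.**  A `some` answer certifies the sign change of `P_{n+1}` across the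
bracket and encloses every node in the bracket together with its weight. [cite: Szego1939, Thm. 3.3.1]
[cite: AbramowitzStegun1964, 25.4.29] [cite: Moore1979, Thm. 3.1] -/
theorem nodeW_spec {n T : ℕ} {c : ℤ} {p : MI × MI} (hT : 0 < T) (h : nodeW n T c = some p) :
    (legendre (n + 1)).eval ((((c - 1 : ℤ)) : ℝ) / T) *
        (legendre (n + 1)).eval ((((c + 1 : ℤ)) : ℝ) / T) < 0 ∧
      ∀ x ∈ gaussLegendreNodes (n + 1), (((c - 1 : ℤ)) : ℝ) / T ≤ x → x ≤ (((c + 1 : ℤ)) : ℝ) / T →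
        MI.mem (bscale T) x p.1 ∧ MI.mem (bscale T) (gaussLegendreWeight (n + 1) x) p.2 := by
  have hSP : 0 < bscale T := by unfold bscale; omega
  have hTz : (0 : ℤ) < (T : ℤ) := by exact_mod_cast hT
  have hXA : MI.mem (bscale T) ((((c - 1 : ℤ)) : ℝ) / T) (MI.ofFrac (bscale T) (c - 1) T) :=
    MI.mem_ofFrac _ _ hT
  have hXB : MI.mem (bscale T) ((((c + 1 : ℤ)) : ℝ) / T) (MI.ofFrac (bscale T) (c + 1) T) :=
    MI.mem_ofFrac _ _ hT
  unfold nodeW at h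
  simp only at h
  split_ifs at h with hsgn
  split at h
  · simp at h
  rename_i W hW
  simp only [Option.some.injEq] at h
  subst h
  refine ⟨?_, ?_⟩
  · have eA : ((((c - 1 : ℤ)) : ℝ) / T) = (((c - 1 : ℤ) : ℝ) / ((T : ℤ) : ℝ)) := by norm_cast
    have eB : ((((c + 1 : ℤ)) : ℝ) / T) = (((c + 1 : ℤ) : ℝ) / ((T : ℤ) : ℝ)) := by norm_cast
    rw [eA, eB]
    rcases hsgn with ⟨h1, h2⟩ | ⟨h1, h2⟩
    · exact mul_neg_of_neg_of_pos (eval_legendre_neg_of_legInt hTz h1)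
        (eval_legendre_pos_of_legInt hTz h2)
    · exact mul_neg_of_pos_of_neg (eval_legendre_pos_of_legInt hTz h1)
        (eval_legendre_neg_of_legInt hTz h2)
  · intro x hx hαx hxβ
    have hxX : MI.mem (bscale T) x
        (MI.span (MI.ofFrac (bscale T) (c - 1) T) (MI.ofFrac (bscale T) (c + 1) T)) :=
      MI.mem_span hXA hXB hαx hxβ
    have hPn := (mem_legPair hSP hxX n).2
    have hnum := MI.mem_mulInt (MI.mem_sub (MI.mem_ofInt (bscale T) 1) (MI.mem_sqr hSP hxX)) 2
    have hden := MI.mem_mulInt (MI.mem_sqr hSP hPn) (((n : ℤ) + 1) ^ 2)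
    have hw := MI.mem_divPos hSP hW hnum hden
    have hweq : ((1 : ℤ) - x ^ 2) * ((2 : ℤ) : ℝ) /
        (((legendre n).eval x) ^ 2 * (((((n : ℤ) + 1) ^ 2 : ℤ)) : ℝ)) =
          gaussLegendreWeight (n + 1) x := by
      rw [Literature.Analysis.SpecialFunctions.gaussLegendreWeight_eq_of_legendre_pred hx]
      push_cast
      ring
    rw [hweq] at hw
    exact ⟨hxX, hw⟩

/-- **Node and weight of one bracket, transported to the axis interval `[a, b]` at scale `S`**:
the node `(b−a)/2·x + (a+b)/2` and the weight `(b−a)/2·λ_x` (`none` if the bracket fails).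
[cite: DavisRabinowitz1984, Sect. 5.6 (5.6.3)] [cite: Szego1939, Thm. 3.3.1] -/
def axisNW (a b : ℚ) (n S T : ℕ) (c : ℤ) : Option (MI × MI) :=
  match nodeW n T c with
  | none => none
  | some p =>
    some ((MI.mul S (ofRat S ((b - a) / 2)) (MI.rescale (bscale T) S p.1)).add (ofRat S ((a + b) / 2)),
      MI.mul S (ofRat S ((b - a) / 2)) (MI.rescale (bscale T) S p.2))

/-- Soundness of `axisNW`. [cite: Szego1939, Thm. 3.3.1] [cite: Moore1979, Thm. 3.1] -/
theorem axisNW_spec {a b : ℚ} {n S T : ℕ} {c : ℤ} {p : MI × MI} (hS : 0 < S) (hT : 0 < T)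
    (h : axisNW a b n S T c = some p) :
    (legendre (n + 1)).eval ((((c - 1 : ℤ)) : ℝ) / T) *
        (legendre (n + 1)).eval ((((c + 1 : ℤ)) : ℝ) / T) < 0 ∧
      ∀ x ∈ gaussLegendreNodes (n + 1), (((c - 1 : ℤ)) : ℝ) / T ≤ x → x ≤ (((c + 1 : ℤ)) : ℝ) / T →
        MI.mem S (((b : ℝ) - a) / 2 * x + ((a : ℝ) + b) / 2) p.1 ∧
          MI.mem S (((b : ℝ) - a) / 2 * gaussLegendreWeight (n + 1) x) p.2 := by
  have hSP : 0 < bscale T := by unfold bscale; omega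
  unfold axisNW at h
  split at h
  · simp at h
  rename_i q hq
  simp only [Option.some.injEq] at h
  subst h
  obtain ⟨hsgn, hmem⟩ := nodeW_spec hT hq
  refine ⟨hsgn, fun x hx hαx hxβ => ?_⟩
  obtain ⟨hxX, hw⟩ := hmem x hx hαx hxβ
  have hxS := MI.mem_rescale hSP S hxX
  have hwS := MI.mem_rescale hSP S hw
  refine ⟨?_, ?_⟩
  · have htI := MI.mem_add (MI.mem_mul hS (mem_ofRat S ((b - a) / 2)) hxS)
      (mem_ofRat S ((a + b) / 2))
    have hteq : ((((b - a) / 2 : ℚ)) : ℝ) * x + ((((a + b) / 2 : ℚ)) : ℝ) =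
        ((b : ℝ) - a) / 2 * x + ((a : ℝ) + b) / 2 := by
      push_cast
      ring
    rw [hteq] at htI
    exact htI
  · have hvI := MI.mem_mul hS (mem_ofRat S ((b - a) / 2)) hwS
    have hveq : ((((b - a) / 2 : ℚ)) : ℝ) * gaussLegendreWeight (n + 1) x =
        ((b : ℝ) - a) / 2 * gaussLegendreWeight (n + 1) x := by
      push_cast
      ring
    rw [hveq] at hvI
    exact hvI

/-- The table of transported nodes and weights of one axis, from the `n+1` node candidates `cs`
(`none` entries mark failed brackets; the certificate rejects them). [cite: Petras2002, Sect. 5.1] -/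
def axisTab (a b : ℚ) (n S T : ℕ) (cs : List ℤ) : List (Option (MI × MI)) :=
  (List.range (n + 1)).map fun i => axisNW a b n S T (cs.getD i 0)

/-- Reading the table. [folklore] -/
private theorem axisTab_getD {a b : ℚ} {n S T : ℕ} {cs : List ℤ} {i : ℕ} (hi : i < n + 1) :
    (axisTab a b n S T cs).getD i none = axisNW a b n S T (cs.getD i 0) := by
  rw [axisTab, List.getD_eq_getElem?_getD, List.getElem?_map, List.getElem?_range hi]
  rfl

/-- **The interval evaluator** of the integrand at a real point `(x, y)`: from `XI ∋ x`, `YI ∋ y`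
(scale `S`, Taylor parameters `K, k`, an enclosure `piI ∋ π` for the argument reduction of `cos`,
`sin`) an enclosure of `f(x, y)` (`none` if a reciprocal or square root cannot be certified or a
kernel declines). [cite: Moore1979, Sect. 4.4 (4.12)] -/
def evalI2 (S K k : ℕ) (piI XI YI : MI) : E2 → Option MI
  | .X => some XI
  | .Y => some YI
  | .const c => some (ofRat S c)
  | .scale q e =>
    match evalI2 S K k piI XI YI e with
    | some A => some (MI.mul S (ofRat S q) A)
    | none => none
  | .add e f =>
    match evalI2 S K k piI XI YI e, evalI2 S K k piI XI YI f with
    | some A, some B => some (A.add B)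
    | _, _ => none
  | .sub e f =>
    match evalI2 S K k piI XI YI e, evalI2 S K k piI XI YI f with
    | some A, some B => some (A.sub B)
    | _, _ => none
  | .neg e =>
    match evalI2 S K k piI XI YI e with
    | some A => some A.neg
    | none => none
  | .mul e f =>
    match evalI2 S K k piI XI YI e, evalI2 S K k piI XI YI f with
    | some A, some B => some (MI.mul S A B)
    | _, _ => none
  | .pow e n =>
    match evalI2 S K k piI XI YI e with
    | some A => some (powI S A n)
    | none => none
  | .exp e =>
    match evalI2 S K k piI XI YI e with
    | some A => MI.exp S K k A
    | none => none
  | .cos e =>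
    match evalI2 S K k piI XI YI e with
    | some A =>
      match MC.expI S K k piI A with
      | some W => some W.re
      | none => none
    | none => none
  | .sin e =>
    match evalI2 S K k piI XI YI e with
    | some A =>
      match MC.expI S K k piI A with
      | some W => some W.im
      | none => none
    | none => none
  | .inv e =>
    match evalI2 S K k piI XI YI e with
    | some A => invI S A
    | none => none
  | .sqrt e =>
    match evalI2 S K k piI XI YI e with
    | some A => sqrtI S A
    | none => none

/-- **Soundness of the interval evaluator.** [cite: Moore1979, Thm. 3.1] -/
theorem mem_evalI2 {S K k : ℕ} (hS : 0 < S) {piI : MI} (hpi : MI.mem S Real.pi piI) {s t : ℝ}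
    {XI YI : MI} (hs : MI.mem S s XI) (ht : MI.mem S t YI) :
    ∀ (e : E2) {Z : MI}, evalI2 S K k piI XI YI e = some Z → MI.mem S (evalR2 e s t) Z := by
  intro e
  induction e with
  | X =>
    intro Z h
    simp only [evalI2, Option.some.injEq] at h
    subst h
    simpa [evalR2] using hs
  | Y =>
    intro Z h
    simp only [evalI2, Option.some.injEq] at h
    subst h
    simpa [evalR2] using ht
  | const c =>
    intro Z h
    simp only [evalI2, Option.some.injEq] at h
    subst h
    simpa [evalR2] using mem_ofRat S c
  | scale q e ih =>
    intro Z h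
    simp only [evalI2] at h
    split at h
    · rename_i A hA
      simp only [Option.some.injEq] at h
      subst h
      simpa [evalR2] using MI.mem_mul hS (mem_ofRat S q) (ih hA)
    · simp at h
  | add e f ihe ihf =>
    intro Z h
    simp only [evalI2] at h
    split at h
    · rename_i A B hA hB
      simp only [Option.some.injEq] at h
      subst h
      exact MI.mem_add (ihe hA) (ihf hB)
    · simp at h
  | sub e f ihe ihf =>
    intro Z h
    simp only [evalI2] at h
    split at h
    · rename_i A B hA hB
      simp only [Option.some.injEq] at h
      subst h
      exact MI.mem_sub (ihe hA) (ihf hB)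
    · simp at h
  | neg e ih =>
    intro Z h
    simp only [evalI2] at h
    split at h
    · rename_i A hA
      simp only [Option.some.injEq] at h
      subst h
      exact MI.mem_neg (ih hA)
    · simp at h
  | mul e f ihe ihf =>
    intro Z h
    simp only [evalI2] at h
    split at h
    · rename_i A B hA hB
      simp only [Option.some.injEq] at h
      subst h
      exact MI.mem_mul hS (ihe hA) (ihf hB)
    · simp at h
  | pow e n ih =>
    intro Z h
    simp only [evalI2] at h
    split at h
    · rename_i A hA
      simp only [Option.some.injEq] at h
      subst h
      exact mem_powI hS (ih hA) n
    · simp at h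
  | exp e ih =>
    intro Z h
    simp only [evalI2] at h
    split at h
    · rename_i A hA
      exact MI.mem_exp hS h (ih hA)
    · simp at h
  | cos e ih =>
    intro Z h
    simp only [evalI2] at h
    split at h
    · rename_i A hA
      split at h
      · rename_i W hW
        simp only [Option.some.injEq] at h
        subst h
        have h1 := (MC.mem_expI hS hpi hW (ih hA)).1
        rw [Complex.exp_ofReal_mul_I_re] at h1
        simpa [evalR2] using h1
      · simp at h
    · simp at h
  | sin e ih =>
    intro Z h
    simp only [evalI2] at h
    split at h
    · rename_i A hA
      split at h
      · rename_i W hW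
        simp only [Option.some.injEq] at h
        subst h
        have h1 := (MC.mem_expI hS hpi hW (ih hA)).2
        rw [Complex.exp_ofReal_mul_I_im] at h1
        simpa [evalR2] using h1
      · simp at h
    · simp at h
  | inv e ih =>
    intro Z h
    simp only [evalI2] at h
    split at h
    · rename_i A hA
      exact mem_invI hS h (ih hA)
    · simp at h
  | sqrt e ih =>
    intro Z h
    simp only [evalI2] at h
    split at h
    · rename_i A hA
      exact mem_sqrtI hS h (ih hA)
    · simp at h

/-- **One row of the product rule**: for a fixed `x`-node (enclosure `XI` of the transported node,
`VI` of its transported weight) the folded sum `Σ_{j<m} v·w_j·f(x, y_j)` over the first `m` entries of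
the `y`-table (`none` if an entry is missing or an evaluation fails).
[cite: DavisRabinowitz1984, Sect. 5.6 (5.6.3)] -/
def rowSum (e : E2) (S K k : ℕ) (piI XI VI : MI) (ty : List (Option (MI × MI))) : ℕ → Option MI
  | 0 => some (MI.ofInt S 0)
  | j + 1 =>
    match rowSum e S K k piI XI VI ty j, ty.getD j none with
    | some acc, some q =>
      match evalI2 S K k piI XI q.1 e with
      | some F => some (acc.add (MI.mul S (MI.mul S VI q.2) F))
      | none => none
    | _, _ => none

/-- A `some` row saw `m` present table entries. [folklore] -/
private theorem rowSum_isSome {e : E2} {S K k : ℕ} {piI XI VI : MI} {ty : List (Option (MI × MI))} :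
    ∀ (m : ℕ) {R : MI}, rowSum e S K k piI XI VI ty m = some R →
      ∀ j < m, ∃ q, ty.getD j none = some q
  | 0 => fun _ j hj => absurd hj (Nat.not_lt_zero j)
  | m + 1 => by
    intro h j hj
    simp only [rowSum] at h
    split at h
    · rename_i acc q hacc hq
      rcases Nat.lt_succ_iff_lt_or_eq.mp hj with hlt | heq
      · exact rowSum_isSome m hacc j hlt
      · subst heq; exact ⟨q, hq⟩
    · simp at h

/-- **Soundness of `rowSum`**: if the table entries enclose the (node, weight) data `u j` and
`XI ∋ x₀`, `VI ∋ v₀`, the row encloses `Σ_{j<m} v₀ · (u j).2 · f(x₀, (u j).1)`. [cite: Moore1979, Thm. 3.1] -/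
theorem rowSum_mem {e : E2} {S K k : ℕ} {piI XI VI : MI} {ty : List (Option (MI × MI))}
    (hS : 0 < S) (hpi : MI.mem S Real.pi piI) {x₀ v₀ : ℝ} (hX : MI.mem S x₀ XI)
    (hV : MI.mem S v₀ VI) (u : ℕ → ℝ × ℝ) :
    ∀ (m : ℕ) {R : MI}, rowSum e S K k piI XI VI ty m = some R →
      (∀ j < m, ∀ q, ty.getD j none = some q → MI.mem S (u j).1 q.1 ∧ MI.mem S (u j).2 q.2) →
        MI.mem S (∑ j ∈ Finset.range m, v₀ * (u j).2 * evalR2 e x₀ (u j).1) R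
  | 0 => by
    intro h _
    simp only [rowSum, Option.some.injEq] at h
    subst h
    simpa using MI.mem_ofInt S 0
  | m + 1 => by
    intro h hu
    simp only [rowSum] at h
    split at h
    · rename_i acc q hacc hq
      split at h
      · rename_i F hF
        simp only [Option.some.injEq] at h
        subst h
        rw [Finset.sum_range_succ]
        have ih := rowSum_mem hS hpi hX hV u m hacc
          (fun j hj q' hq' => hu j (Nat.lt_succ_of_lt hj) q' hq')
        have huj := hu m (Nat.lt_succ_self m) q hq
        exact MI.mem_add ih
          (MI.mem_mul hS (MI.mem_mul hS hV huj.2) (mem_evalI2 hS hpi hX huj.1 e hF))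
      · simp at h
    · simp at h

/-- **The product rule, folded**: `Σ_{i<l} rowSum_i` over the first `l` entries of the `x`-table, each
row over the first `m` entries of the `y`-table. [cite: DavisRabinowitz1984, Sect. 5.6 (5.6.3)] -/
def dblSum (e : E2) (S K k : ℕ) (piI : MI) (tx ty : List (Option (MI × MI))) (m : ℕ) :
    ℕ → Option MI
  | 0 => some (MI.ofInt S 0)
  | i + 1 =>
    match dblSum e S K k piI tx ty m i, tx.getD i none with
    | some acc, some p =>
      match rowSum e S K k piI p.1 p.2 ty m with
      | some R => some (acc.add R)
      | none => none
    | _, _ => none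

/-- A `some` double sum saw `l` present `x`-entries with `some` rows. [folklore] -/
private theorem dblSum_isSome {e : E2} {S K k : ℕ} {piI : MI} {tx ty : List (Option (MI × MI))}
    {m : ℕ} : ∀ (l : ℕ) {D : MI}, dblSum e S K k piI tx ty m l = some D →
      ∀ i < l, ∃ p, tx.getD i none = some p ∧ ∃ R, rowSum e S K k piI p.1 p.2 ty m = some R
  | 0 => fun _ i hi => absurd hi (Nat.not_lt_zero i)
  | l + 1 => by
    intro h i hi
    simp only [dblSum] at h
    split at h
    · rename_i acc p hacc hp
      split at h
      · rename_i R hR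
        rcases Nat.lt_succ_iff_lt_or_eq.mp hi with hlt | heq
        · exact dblSum_isSome l hacc i hlt
        · subst heq; exact ⟨p, hp, R, hR⟩
      · simp at h
    · simp at h

/-- **Soundness of `dblSum`**: with `x`-data `xu i` and `y`-data `u j` enclosed by the tables, the
double sum encloses `Σ_{i<l} Σ_{j<m} (xu i).2 (u j).2 f((xu i).1, (u j).1)`. [cite: Moore1979, Thm. 3.1] -/
theorem dblSum_mem {e : E2} {S K k : ℕ} {piI : MI} {tx ty : List (Option (MI × MI))} {m : ℕ}
    (hS : 0 < S) (hpi : MI.mem S Real.pi piI) (xu u : ℕ → ℝ × ℝ)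
    (hu : ∀ j < m, ∀ q, ty.getD j none = some q → MI.mem S (u j).1 q.1 ∧ MI.mem S (u j).2 q.2) :
    ∀ (l : ℕ) {D : MI}, dblSum e S K k piI tx ty m l = some D →
      (∀ i < l, ∀ p, tx.getD i none = some p → MI.mem S (xu i).1 p.1 ∧ MI.mem S (xu i).2 p.2) →
        MI.mem S (∑ i ∈ Finset.range l, ∑ j ∈ Finset.range m,
          (xu i).2 * (u j).2 * evalR2 e (xu i).1 (u j).1) D
  | 0 => by
    intro h _
    simp only [dblSum, Option.some.injEq] at h
    subst h
    simpa using MI.mem_ofInt S 0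
  | l + 1 => by
    intro h hxu
    simp only [dblSum] at h
    split at h
    · rename_i acc p hacc hp
      split at h
      · rename_i R hR
        simp only [Option.some.injEq] at h
        subst h
        rw [Finset.sum_range_succ]
        have ih := dblSum_mem hS hpi xu u hu l hacc
          (fun i hi p' hp' => hxu i (Nat.lt_succ_of_lt hi) p' hp')
        have hxl := hxu l (Nat.lt_succ_self l) p hp
        exact MI.mem_add ih (rowSum_mem hS hpi hxl.1 hxl.2 u m hR hu)
      · simp at h
    · simp at h

/-- The certified error radius `(b − a)·ε_y + (d − c)·ε_x` of Haber's estimate as a rational, with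
`ε_y = (d−c)/2 · 8·ub_y/((ρ₂ − 1) ρ₂^{2n₂+1})`, `ε_x = (b−a)/2 · 8·ub_x/((ρ₁ − 1) ρ₁^{2n₁+1})`.
[cite: DavisRabinowitz1984, Sect. 5.6 (5.6.3)] [cite: Trefethen2008, Thm. 4.5] -/
def errQ2 (e : E2) (a b c d ρ₁ ρ₂ : ℚ) (n₁ n₂ : ℕ) : ℚ :=
  (b - a) * ((d - c) / 2 * (8 * (ebnd2 (realB a b) (EB.varB ρ₂ c d) e).ub /
      ((ρ₂ - 1) * ρ₂ ^ (2 * (n₂ + 1) - 1)))) +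
    (d - c) * ((b - a) / 2 * (8 * (ebnd2 (EB.varB ρ₁ a b) (realB c d) e).ub /
      ((ρ₁ - 1) * ρ₁ ^ (2 * (n₁ + 1) - 1))))

/-- The certificate data: the enclosure `D ∋ Q·S` of the product rule's value
`Q = Σ_i Σ_j v_i w_j f(x_i, y_j)` and `E ∋ errQ2·S` of the error radius (`none` if `π` or a term
cannot be enclosed) — `#eval` it to choose `lo, hi`. [cite: DavisRabinowitz1984, Sect. 5.6 (5.6.3)] -/
def glData2 (e : E2) (a b c d ρ₁ ρ₂ : ℚ) (n₁ n₂ S T K k : ℕ) (csx csy : List ℤ) :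
    Option (MI × MI) :=
  match MI.pi S K with
  | none => none
  | some piI =>
    match dblSum e S K k piI (axisTab a b n₁ S T csx) (axisTab c d n₂ S T csy) (n₂ + 1) (n₁ + 1) with
    | none => none
    | some D => some (D, ofRat S (errQ2 e a b c d ρ₁ ρ₂ n₁ n₂))

/-- **The certificate (data form).**  `glCheck2D e a b c d ρ₁ ρ₂ n₁ n₂ S T K k csx csy lo hi`
checks, by integer arithmetic only: `ρ₁, ρ₂ > 1`, `a < b`, `c < d`, the side conditions of BOTH
families of sections (`eok2 (varB ρ₁ a b) (realB c d) e`, `eok2 (realB a b) (varB ρ₂ c d) e`),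
`S, T > 0`, that the `n₁+1` (resp. `n₂+1`) node candidates (numerators at scale `T`, ascending) are
separated (`cᵢ + 2 < cᵢ₊₁`), that every bracket of both axes passes `nodeW` and every one of the
`(n₁+1)(n₂+1)` integrand evaluations succeeds, and that the product-rule sum `± errQ2` computed at
scale `S` lies inside `[lo, hi]` — the product Gauss rule of (5.6.3) with Haber's error estimate, both
one-dimensional steps being Petras–Johansson steps with certified rather than tabulated nodes.
[cite: DavisRabinowitz1984, Sect. 5.6 (5.6.3)] [cite: Petras2002, Sect. 3 (2)]
[cite: Johansson2018, Sect. 2] -/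
def glCheck2D (e : E2) (a b c d ρ₁ ρ₂ : ℚ) (n₁ n₂ S T K k : ℕ) (csx csy : List ℤ) (lo hi : ℚ) :
    Bool :=
  decide (1 < ρ₁) && decide (1 < ρ₂) && decide (a < b) && decide (c < d) &&
    eok2 (EB.varB ρ₁ a b) (realB c d) e && eok2 (realB a b) (EB.varB ρ₂ c d) e &&
    decide (0 < S) && decide (0 < T) &&
    decide (∀ j < n₁, csx.getD j 0 + 2 < csx.getD (j + 1) 0) &&
    decide (∀ j < n₂, csy.getD j 0 + 2 < csy.getD (j + 1) 0) &&
    match glData2 e a b c d ρ₁ ρ₂ n₁ n₂ S T K k csx csy with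
    | none => false
    | some D =>
      decide (lo.num * (S : ℤ) ≤ (D.1.lo - D.2.hi) * (lo.den : ℤ)) &&
        decide ((D.1.hi + D.2.hi) * (hi.den : ℤ) ≤ hi.num * (S : ℤ))

/-- Separated consecutive candidates are pairwise separated. [folklore] -/
private theorem sep_of_chain {c : ℕ → ℤ} {n : ℕ} (h : ∀ j < n, c j + 2 < c (j + 1)) :
    ∀ i j : ℕ, i < j → j ≤ n → c i + 2 < c j := by
  intro i j hij hjn
  induction j with
  | zero => exact absurd hij (Nat.not_lt_zero i)
  | succ j ih =>
    rcases Nat.lt_succ_iff_lt_or_eq.mp hij with hlt | heq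
    · have h1 := ih hlt (by omega)
      have h2 := h j (by omega)
      linarith
    · subst heq
      linarith [h i (by omega)]

/-- **The brackets of one axis are the nodes of its rule.**  If the `n+1` candidates are separated and
every bracket passes `axisNW`, there is an enumeration `ξ` of nodes, bracket by bracket, such that every
sum over the nodes of the `(n+1)`-point rule is the sum over the brackets (one node in each bracket by
`existsUnique_gaussLegendreNode_mem_Icc`, none outside by `exists_gaussLegendreNode_mem_Ioo`).
[cite: Szego1939, Thm. 3.3.1] -/
theorem axis_nodes {a b : ℚ} {n S T : ℕ} {cs : List ℤ} (hS : 0 < S) (hT : 0 < T)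
    (hsep : ∀ j < n, cs.getD j 0 + 2 < cs.getD (j + 1) 0)
    (hNW : ∀ i < n + 1, ∃ p, axisNW a b n S T (cs.getD i 0) = some p) :
    ∃ ξ : Fin (n + 1) → ℝ, (∀ i, ξ i ∈ gaussLegendreNodes (n + 1)) ∧
      (∀ i : Fin (n + 1),
        (((cs.getD i 0 - 1 : ℤ)) : ℝ) / T ≤ ξ i ∧ ξ i ≤ (((cs.getD i 0 + 1 : ℤ)) : ℝ) / T) ∧
      ∀ G : ℝ → ℝ, ∑ i, G (ξ i) = ∑ x ∈ gaussLegendreNodes (n + 1), G x := by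
  have hTr : (0 : ℝ) < T := by exact_mod_cast hT
  set α : Fin (n + 1) → ℝ := fun i => (((cs.getD i 0 - 1 : ℤ)) : ℝ) / T with hαdef
  set β : Fin (n + 1) → ℝ := fun i => (((cs.getD i 0 + 1 : ℤ)) : ℝ) / T with hβdef
  have hαβ : ∀ i, α i ≤ β i := by
    intro i
    simp only [hαdef, hβdef]
    push_cast
    exact div_le_div_of_nonneg_right (by linarith) hTr.le
  have hsign : ∀ i, (legendre (n + 1)).eval (α i) * (legendre (n + 1)).eval (β i) < 0 := by
    intro i
    obtain ⟨p, hp⟩ := hNW i i.2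
    exact (axisNW_spec hS hT hp).1
  have hdisj : Pairwise fun i j => Disjoint (Set.Icc (α i) (β i)) (Set.Icc (α j) (β j)) := by
    have hsep' := sep_of_chain (c := fun j => cs.getD j 0) hsep
    have hlt : ∀ i j : Fin (n + 1), (i : ℕ) < j → β i < α j := by
      intro i j hij
      have h3 : cs.getD i 0 + 2 < cs.getD j 0 := hsep' i j hij (by omega)
      simp only [hαdef, hβdef]
      push_cast
      have h4 : ((cs.getD i 0 : ℤ) : ℝ) + 2 < ((cs.getD j 0 : ℤ) : ℝ) := by exact_mod_cast h3
      exact div_lt_div_of_pos_right (by linarith) hTr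
    intro i j hne
    rcases lt_or_gt_of_ne (Fin.val_ne_of_ne hne) with hij | hji
    · exact Set.disjoint_left.mpr fun x hx hx' => by linarith [hx.2, hx'.1, hlt i j hij]
    · exact Set.disjoint_left.mpr fun x hx hx' => by linarith [hx.1, hx'.2, hlt j i hji]
  have hcard : Fintype.card (Fin (n + 1)) = n + 1 := Fintype.card_fin _
  have hex := existsUnique_gaussLegendreNode_mem_Icc hcard hαβ hsign hdisj
  have hξex : ∀ i, ∃ x, x ∈ Set.Icc (α i) (β i) ∧ x ∈ gaussLegendreNodes (n + 1) :=
    fun i => (hex i).exists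
  choose ξ hξ using hξex
  refine ⟨ξ, fun i => (hξ i).2, fun i => ?_, fun G => ?_⟩
  · have hb := (hξ i).1
    simp only [hαdef, hβdef, Set.mem_Icc] at hb
    exact hb
  · refine Finset.sum_nbij ξ (fun i _ => ?_) (fun i _ j _ hij => ?_) (fun x hx => ?_) (fun _ _ => rfl)
    · exact (hξ i).2
    · by_contra hne
      have hd := hdisj hne
      exact Set.disjoint_left.mp hd (hξ i).1 (hij ▸ (hξ j).1)
    · have hx' : x ∈ gaussLegendreNodes (n + 1) := by exact_mod_cast hx
      obtain ⟨i, hi⟩ := exists_gaussLegendreNode_mem_Ioo hcard hαβ hsign hdisj hx'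
      refine ⟨i, by simp, ?_⟩
      exact (hex i).unique (hξ i) ⟨Set.Ioo_subset_Icc_self hi, hx'⟩

/-- **Kernel-checked enclosure of `∫ₐᵇ ∫_c^d f(x, y) dy dx` by product Gauss–Legendre cubature.**
One `decide` of `glCheck2D` proves `∫ₐᵇ ∫_c^d evalR2 e x y ∈ [lo, hi]`: the brackets of each axis
certify exactly the nodes of its rule (`axis_nodes`), so the interval double sum encloses the product
rule's value, and Part C (Trefethen's bound in each direction, Haber's estimate) bounds its distance to
the iterated integral. [cite: DavisRabinowitz1984, Sect. 5.6 (5.6.3)] [cite: Trefethen2008, Thm. 4.5]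
[cite: Petras2002, Sect. 3 (2)] [cite: Szego1939, Thm. 3.3.1] -/
theorem integral_mem_of_glCheck2D {e : E2} {a b c d ρ₁ ρ₂ : ℚ} {n₁ n₂ S T K k : ℕ}
    {csx csy : List ℤ} {lo hi : ℚ}
    (h : glCheck2D e a b c d ρ₁ ρ₂ n₁ n₂ S T K k csx csy lo hi = true) :
    (∫ x in (a : ℝ)..b, ∫ y in (c : ℝ)..d, evalR2 e x y) ∈ Set.Icc (lo : ℝ) hi := by
  unfold glCheck2D at h
  simp only [Bool.and_eq_true, decide_eq_true_eq] at h
  obtain ⟨⟨⟨⟨⟨⟨⟨⟨⟨⟨hρ₁, hρ₂⟩, hab⟩, hcd⟩, hokx⟩, hoky⟩, hS⟩, hT⟩, hsepx⟩, hsepy⟩, hrest⟩ := h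
  split at hrest
  · simp at hrest
  rename_i D hD
  simp only [Bool.and_eq_true, decide_eq_true_eq] at hrest
  obtain ⟨h1, h2⟩ := hrest
  unfold glData2 at hD
  split at hD
  · simp at hD
  rename_i piI hpiEq
  split at hD
  · simp at hD
  rename_i Dg hDg
  simp only [Option.some.injEq] at hD
  subst hD
  dsimp only at h1 h2
  have hSr : (0 : ℝ) < S := by exact_mod_cast hS
  have hab' : (a : ℝ) < b := by exact_mod_cast hab
  have hcd' : (c : ℝ) < d := by exact_mod_cast hcd
  have hpi := MI.mem_pi S hpiEq
  -- every bracket of both axes passed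
  have hrows := dblSum_isSome (n₁ + 1) hDg
  have hxNW : ∀ i < n₁ + 1, ∃ p, axisNW a b n₁ S T (csx.getD i 0) = some p := by
    intro i hi
    obtain ⟨p, hp, -⟩ := hrows i hi
    exact ⟨p, by rw [← axisTab_getD hi]; exact hp⟩
  have hyNW : ∀ j < n₂ + 1, ∃ q, axisNW c d n₂ S T (csy.getD j 0) = some q := by
    obtain ⟨p, -, R, hR⟩ := hrows 0 (Nat.succ_pos _)
    intro j hj
    obtain ⟨q, hq⟩ := rowSum_isSome (n₂ + 1) hR j hj
    exact ⟨q, by rw [← axisTab_getD hj]; exact hq⟩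
  obtain ⟨ξ, hξn, hξb, hξsum⟩ := axis_nodes hS hT hsepx hxNW
  obtain ⟨η, hηn, hηb, hηsum⟩ := axis_nodes hS hT hsepy hyNW
  -- the product rule's value and its bracket-by-bracket form
  set xn : ℝ → ℝ := fun ξ' => ((b : ℝ) - a) / 2 * ξ' + ((a : ℝ) + b) / 2 with hxndef
  set yn : ℝ → ℝ := fun η' => ((d : ℝ) - c) / 2 * η' + ((c : ℝ) + d) / 2 with hyndef
  set v : ℝ → ℝ := fun ξ' => ((b : ℝ) - a) / 2 * gaussLegendreWeight (n₁ + 1) ξ' with hvdef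
  set w : ℝ → ℝ := fun η' => ((d : ℝ) - c) / 2 * gaussLegendreWeight (n₂ + 1) η' with hwdef
  set Q : ℝ := ∑ ξ' ∈ gaussLegendreNodes (n₁ + 1), ∑ η' ∈ gaussLegendreNodes (n₂ + 1),
    v ξ' * w η' * evalR2 e (xn ξ') (yn η') with hQdef
  have hQfin : Q = ∑ i : Fin (n₁ + 1), ∑ j : Fin (n₂ + 1),
      v (ξ i) * w (η j) * evalR2 e (xn (ξ i)) (yn (η j)) := by
    have e1 := hξsum (fun x' => ∑ η' ∈ gaussLegendreNodes (n₂ + 1),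
      v x' * w η' * evalR2 e (xn x') (yn η'))
    rw [hQdef, ← e1]
    refine Finset.sum_congr rfl (fun i _ => ?_)
    have e2 := hηsum (fun y' => v (ξ i) * w y' * evalR2 e (xn (ξ i)) (yn y'))
    rw [← e2]
  -- the interval double sum encloses the rule
  set xu : ℕ → ℝ × ℝ := fun i => if hi : i < n₁ + 1 then (xn (ξ ⟨i, hi⟩), v (ξ ⟨i, hi⟩)) else (0, 0)
    with hxudef
  set u : ℕ → ℝ × ℝ := fun j => if hj : j < n₂ + 1 then (yn (η ⟨j, hj⟩), w (η ⟨j, hj⟩)) else (0, 0)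
    with hudef
  have hxu : ∀ i < n₁ + 1, ∀ p, (axisTab a b n₁ S T csx).getD i none = some p →
      MI.mem S (xu i).1 p.1 ∧ MI.mem S (xu i).2 p.2 := by
    intro i hi p hp
    rw [axisTab_getD hi] at hp
    have hsp := (axisNW_spec hS hT hp).2 (ξ ⟨i, hi⟩) (hξn _) (hξb ⟨i, hi⟩).1 (hξb ⟨i, hi⟩).2
    simp only [hxudef, dif_pos hi]
    exact hsp
  have hu : ∀ j < n₂ + 1, ∀ q, (axisTab c d n₂ S T csy).getD j none = some q →
      MI.mem S (u j).1 q.1 ∧ MI.mem S (u j).2 q.2 := by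
    intro j hj q hq
    rw [axisTab_getD hj] at hq
    have hsp := (axisNW_spec hS hT hq).2 (η ⟨j, hj⟩) (hηn _) (hηb ⟨j, hj⟩).1 (hηb ⟨j, hj⟩).2
    simp only [hudef, dif_pos hj]
    exact hsp
  have hmem := dblSum_mem hS hpi xu u hu (n₁ + 1) hDg hxu
  have hsumEq : ∑ i ∈ Finset.range (n₁ + 1), ∑ j ∈ Finset.range (n₂ + 1),
      (xu i).2 * (u j).2 * evalR2 e (xu i).1 (u j).1 = Q := by
    rw [hQfin, Finset.sum_range]
    refine Finset.sum_congr rfl (fun i _ => ?_)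
    rw [Finset.sum_range]
    refine Finset.sum_congr rfl (fun j _ => ?_)
    simp only [hxudef, hudef, dif_pos i.2, dif_pos j.2]
  rw [hsumEq] at hmem
  -- the error estimate
  set I : ℝ := ∫ x in (a : ℝ)..b, ∫ y in (c : ℝ)..d, evalR2 e x y with hIdef
  set εy : ℝ := ((d : ℝ) - c) / 2 * (8 * ((ebnd2 (realB a b) (EB.varB ρ₂ c d) e).ub : ℝ) /
    (((ρ₂ : ℝ) - 1) * (ρ₂ : ℝ) ^ (2 * (n₂ + 1) - 1))) with hεy
  set εx : ℝ := ((b : ℝ) - a) / 2 * (8 * ((ebnd2 (EB.varB ρ₁ a b) (realB c d) e).ub : ℝ) /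
    (((ρ₁ : ℝ) - 1) * (ρ₁ : ℝ) ^ (2 * (n₁ + 1) - 1))) with hεx
  have hy : ∀ x ∈ Set.Icc (a : ℝ) b,
      |(∫ y in (c : ℝ)..d, evalR2 e x y) - glRule n₂ c d (evalR2 e x)| ≤ εy :=
    fun x hx => abs_integral_sub_gl_le_y hρ₂ hcd hoky hx n₂
  have hx : ∀ y ∈ Set.Icc (c : ℝ) d,
      |(∫ x in (a : ℝ)..b, evalR2 e x y) - glRule n₁ a b (fun x => evalR2 e x y)| ≤ εx :=
    fun y hy' => abs_integral_sub_gl_le_x hρ₁ hab hokx hy' n₁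
  have hM : ∀ x ∈ Set.Icc (a : ℝ) b, ∀ y ∈ Set.Icc (c : ℝ) d,
      |evalR2 e x y| ≤ ((ebnd2 (realB a b) (EB.varB ρ₂ c d) e).ub : ℝ) :=
    fun x hx y hy' => abs_evalR2_le hρ₂ hcd hoky hx hy'
  obtain ⟨hg, hs⟩ := integrable_of_measurable_bound (measurable_evalR2 e) hab'.le hcd'.le hM
  have habs : |I - Q| ≤ ((b : ℝ) - a) * εy + ((d : ℝ) - c) * εx := by
    have := abs_integral2_sub_gl2_le hab' hcd' hy hx hg hs
    simpa only [hIdef, hQdef, hxndef, hyndef, hvdef, hwdef, hεy, hεx] using this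
  rw [abs_le] at habs
  set ε : ℝ := ((b : ℝ) - a) * εy + ((d : ℝ) - c) * εx with hε
  have herr : MI.mem S ε (ofRat S (errQ2 e a b c d ρ₁ ρ₂ n₁ n₂)) := by
    have := mem_ofRat S (errQ2 e a b c d ρ₁ ρ₂ n₁ n₂)
    convert this using 2
    rw [hε, hεy, hεx, errQ2]
    push_cast
    ring
  obtain ⟨hA1, hA2⟩ := hmem
  obtain ⟨hB1, hB2⟩ := herr
  have h1r : (lo.num : ℝ) * S ≤
      ((Dg.lo : ℝ) - (ofRat S (errQ2 e a b c d ρ₁ ρ₂ n₁ n₂)).hi) * lo.den := by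
    exact_mod_cast h1
  have h2r : ((Dg.hi : ℝ) + (ofRat S (errQ2 e a b c d ρ₁ ρ₂ n₁ n₂)).hi) * hi.den ≤ hi.num * S := by
    exact_mod_cast h2
  have hdlo : (0 : ℝ) < lo.den := by exact_mod_cast lo.den_pos
  have hdhi : (0 : ℝ) < hi.den := by exact_mod_cast hi.den_pos
  constructor
  · have keylo : (lo.num : ℝ) * S ≤ I * lo.den * S := by
      calc (lo.num : ℝ) * S ≤ ((Dg.lo : ℝ) - (ofRat S (errQ2 e a b c d ρ₁ ρ₂ n₁ n₂)).hi) * lo.den :=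
            h1r
        _ ≤ (Q - ε) * S * lo.den := by
            apply mul_le_mul_of_nonneg_right _ hdlo.le
            linarith
        _ ≤ I * S * lo.den := by
            apply mul_le_mul_of_nonneg_right _ hdlo.le
            apply mul_le_mul_of_nonneg_right _ hSr.le
            linarith
        _ = I * lo.den * S := by ring
    have keylo' : (lo.num : ℝ) ≤ I * lo.den := le_of_mul_le_mul_right keylo hSr
    show (lo : ℝ) ≤ I
    rw [Rat.cast_def, div_le_iff₀ hdlo]
    exact keylo'
  · have keyhi : I * hi.den * S ≤ (hi.num : ℝ) * S := by
      calc I * hi.den * S = I * S * hi.den := by ring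
        _ ≤ (Q + ε) * S * hi.den := by
            apply mul_le_mul_of_nonneg_right _ hdhi.le
            apply mul_le_mul_of_nonneg_right _ hSr.le
            linarith
        _ ≤ ((Dg.hi : ℝ) + (ofRat S (errQ2 e a b c d ρ₁ ρ₂ n₁ n₂)).hi) * hi.den := by
            apply mul_le_mul_of_nonneg_right _ hdhi.le
            linarith
        _ ≤ hi.num * S := h2r
    have keyhi' : I * hi.den ≤ (hi.num : ℝ) := le_of_mul_le_mul_right keyhi hSr
    show I ≤ (hi : ℝ)
    rw [Rat.cast_def, le_div_iff₀ hdhi]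
    exact keyhi'

/-- **The certificate (self-contained form)**: `glCheck2D` with the node candidates `glCands n₁ T`,
`glCands n₂ T` computed inside the check (the kernel then also runs the two Newton searches; for
large degrees paste `#eval glCands n T` into `glCheck2D` instead). [cite: Petras2002, Sect. 3 (2)] -/
def glCheck2 (e : E2) (a b c d ρ₁ ρ₂ : ℚ) (n₁ n₂ S T K k : ℕ) (lo hi : ℚ) : Bool :=
  glCheck2D e a b c d ρ₁ ρ₂ n₁ n₂ S T K k (glCands n₁ T) (glCands n₂ T) lo hi

/-- **Kernel-checked enclosure of `∫ₐᵇ ∫_c^d f(x, y) dy dx`, self-contained form.**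
[cite: DavisRabinowitz1984, Sect. 5.6 (5.6.3)] [cite: Trefethen2008, Thm. 4.5]
[cite: Petras2002, Sect. 3 (2)] -/
theorem integral_mem_of_glCheck2 {e : E2} {a b c d ρ₁ ρ₂ : ℚ} {n₁ n₂ S T K k : ℕ} {lo hi : ℚ}
    (h : glCheck2 e a b c d ρ₁ ρ₂ n₁ n₂ S T K k lo hi = true) :
    (∫ x in (a : ℝ)..b, ∫ y in (c : ℝ)..d, evalR2 e x y) ∈ Set.Icc (lo : ℝ) hi :=
  integral_mem_of_glCheck2D h

end GaussLegendre2D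

end Literature.Analysis.ValidatedNumerics
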